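import Literature.Computability.Complexity.ZIntBricks
import Mathlib.Data.Rat.Floor
import Mathlib.Algebra.Order.Round
import HarnessLib

/-!
# Rational-number bricks in the `FP` string algebra: lowest-terms codes, normalisation, rounding

Trunk `CplxCore`, toolkit continuing `ZIntBricks.lean` (integers as canonical difference pairs
`dpEnc z`, `zaddF`, `zmulF`, `zquoPosF`, …) and `StackBricksArith.lean` (`gcdFn`, `divFn`). A
machine that computes with exact rationals whose *lowest-terms* numerator and denominator enter
later decisions (Mathlib's `ℚ` is normalised: `q.num`, `q.den` are coprime, and a specification
written with `q.den` — a grid of points `r - β + i · 2β/L` whose denominators scale the next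
query, as in the binary search of Aaronson–Arkhipov 2013, Thm. 4.3 — forces the machine to reduce
fractions exactly as `ℚ` does) needs three total string functions with closed-form values:

* `Brick.qEnc q = ⟨dpEnc q.num, bin q.den⟩`, the code of a rational (injective);
* `Brick.zmagF w = bin |ival w|` (magnitude of a difference pair) and
  `Brick.qgcdF ⟨a, M⟩ = bin (gcd |ival a| ⟦M⟧)`;
* **`Brick.qnormF ⟨a, M⟩ = qEnc (ival a / ⟦M⟧)`** for `⟦M⟧ > 0` (`qnormF_boolPair`): divide the
  numerator (`zquoPosF`, exact since the gcd divides it) and the denominator (`divFn`) by the gcd —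
  this is `Rat.num_mkRat`/`Rat.den_mkRat`;
* **`Brick.qroundF ⟨a, M⟩ = dpEnc (round (ival a / ⟦M⟧))`** for `⟦M⟧ > 0` (`qroundF_boolPair`):
  `round x = ⌊x + 1/2⌋ = ⌊(2 Z + M)/(2 M)⌋`, an integer floor division (`Rat.floor_intCast_div_natCast`);
* the arithmetic of codes needed to feed them: `Brick.natZF u = ⟨u, ε⟩` (a numeral as a
  nonnegative difference pair), membership in `FP` of everything, and the length of `qEnc`.

## References

* D. E. Knuth, *The Art of Computer Programming*, Vol. 2, 3rd ed., Addison-Wesley 1998, §4.5.1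
  (fractions: `(u/u') → (u/d)/(u'/d)`, `d = gcd(u, u')`). (Schoolbook; fully proved here.)
* S. Arora, B. Barak, *Computational Complexity: A Modern Approach*, CUP 2009, §1.3 (closure of
  polynomial time under composition).
-/

namespace Literature.Computability.Complexity

open _root_.Computability Polynomial

namespace Brick

/-! ### The code of a rational -/

/-- **The code of a rational number**: its lowest-terms numerator as a canonical difference pair and
its (positive) denominator as a numeral, `⟨dpEnc q.num, bin q.den⟩`. [cite: KnuthTAOCP2, §4.5.1] -/
def qEnc (q : ℚ) : List Bool := boolPair (dpEnc q.num) (encodeNat q.den)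

/-- The numerator field. [folklore] -/
@[simp] theorem fstF_qEnc (q : ℚ) : fstF (qEnc q) = dpEnc q.num := by simp [qEnc]

/-- The denominator field. [folklore] -/
@[simp] theorem sndF_qEnc (q : ℚ) : sndF (qEnc q) = encodeNat q.den := by simp [qEnc]

/-- `boolUnpair` of the code. [folklore] -/
@[simp] theorem boolUnpair_qEnc (q : ℚ) : boolUnpair (qEnc q) = (dpEnc q.num, encodeNat q.den) := by
  simp [qEnc]

/-- The code is injective. [folklore] -/
theorem qEnc_injective : Function.Injective qEnc := fun p q h => by
  have h1 := congrArg (fun w => ival (fstF w)) h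
  have h2 := congrArg (fun w => bitsToNat (sndF w)) h
  simp only [fstF_qEnc, ival_dpEnc, sndF_qEnc, bitsToNat_encodeNat] at h1 h2
  exact Rat.ext h1 h2

/-- Length of the code. [folklore] -/
theorem length_qEnc (q : ℚ) : (qEnc q).length = 2 * (dpEnc q.num).length + 2 + (encodeNat q.den).length := by
  rw [qEnc, length_boolPair]

/-- Length of the code in terms of the binary sizes of numerator and denominator. [folklore] -/
theorem length_qEnc_le (q : ℚ) : (qEnc q).length ≤ 4 * (encodeNat q.num.natAbs).length + (encodeNat q.den).length + 6 := by
  rw [length_qEnc]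
  have := length_dpEnc_le_two_mul q.num
  omega

/-! ### Magnitude and gcd -/

/-- **The magnitude of a difference pair** as a numeral: `bin |ival w|` (canonicalise, then add the
two components, one of which is empty). [folklore] -/
noncomputable def zmagF : List Bool → List Bool := addFn ∘ zcanonF

/-- `zmagF w = bin |ival w|` on every `w`. [folklore] -/
@[simp] theorem zmagF_apply (w : List Bool) : zmagF w = encodeNat (ival w).natAbs := by
  rw [zmagF, Function.comp_apply, zcanonF_eq, dpEnc_eq, addFn_boolPair, bitsToNat_cP_add_cQ]

/-- `zmagF ∈ FP`. [cite: AroraBarak2009, §1.3] -/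
theorem zmagF_mem_FP : zmagF ∈ FP := comp_mem_FP addFn_mem_FP zcanonF_mem_FP

/-- `|zmagF w| ≤ |w|`. [folklore] -/
theorem length_zmagF_le (w : List Bool) : (zmagF w).length ≤ w.length := by
  rw [zmagF_apply]
  exact (length_encodeNat_natAbs_ival_le w).trans (zlen_le_length w)

/-- **The gcd of the magnitude of the numerator field and the denominator field**:
`qgcdF ⟨a, M⟩ = bin (gcd |ival a| ⟦M⟧)`. [cite: KnuthTAOCP2, §4.5.1] -/
noncomputable def qgcdF : List Bool → List Bool := gcdFn ∘ fanoutFn (zmagF ∘ fstF) sndF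

/-- Value of `qgcdF`. [folklore] -/
@[simp] theorem qgcdF_boolPair (a M : List Bool) :
    qgcdF (boolPair a M) = encodeNat ((ival a).natAbs.gcd (bitsToNat M)) := by
  simp [qgcdF]

/-- `qgcdF ∈ FP`. [cite: AroraBarak2009, §1.3] -/
theorem qgcdF_mem_FP : qgcdF ∈ FP :=
  comp_mem_FP gcdFn_mem_FP (fanoutFn_mem_FP (comp_mem_FP zmagF_mem_FP fstF_mem_FP) sndF_mem_FP)

/-! ### Normalisation -/

/-- **Reduction to lowest terms**: `⟨a, M⟩ ↦ ⟨dpEnc (ival a / d), bin (⟦M⟧ / d)⟩` with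
`d = gcd |ival a| ⟦M⟧` (integer division of the canonicalised numerator by the positive numeral `d`,
`zquoPosF`; natural division of the denominator, `divFn`). [cite: KnuthTAOCP2, §4.5.1] -/
noncomputable def qnormF : List Bool → List Bool :=
  fanoutFn (zquoPosF ∘ fanoutFn (zcanonF ∘ fstF) qgcdF) (divFn ∘ fanoutFn sndF qgcdF)

/-- `qnormF ∈ FP`. [cite: AroraBarak2009, §1.3] -/
theorem qnormF_mem_FP : qnormF ∈ FP :=
  fanoutFn_mem_FP (comp_mem_FP zquoPosF_mem_FP (fanoutFn_mem_FP (comp_mem_FP zcanonF_mem_FP fstF_mem_FP) qgcdF_mem_FP))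
    (comp_mem_FP divFn_mem_FP (fanoutFn_mem_FP sndF_mem_FP qgcdF_mem_FP))

/-- The lowest-terms numerator and denominator of `Z / M` (`M > 0`): divide by `gcd |Z| M`
(`Rat.num_mkRat`, `Rat.den_mkRat`). [cite: KnuthTAOCP2, §4.5.1] -/
theorem num_den_intCast_div_natCast (Z : ℤ) {M : ℕ} (hM : 0 < M) :
    ((Z : ℚ) / (M : ℚ)).num = Z / ((Z.natAbs.gcd M : ℕ) : ℤ) ∧ ((Z : ℚ) / (M : ℚ)).den = M / Z.natAbs.gcd M := by
  rw [← Rat.mkRat_eq_div, Rat.num_mkRat, Rat.den_mkRat, if_neg hM.ne', if_neg hM.ne', Nat.gcd_comm]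
  exact ⟨rfl, rfl⟩

/-- **`qnormF ⟨a, M⟩ = qEnc (ival a / ⟦M⟧)`** for a positive denominator numeral. [cite: KnuthTAOCP2, §4.5.1] -/
theorem qnormF_boolPair (a M : List Bool) (hM : 0 < bitsToNat M) :
    qnormF (boolPair a M) = qEnc ((ival a : ℚ) / (bitsToNat M : ℚ)) := by
  obtain ⟨hnum, hden⟩ := num_den_intCast_div_natCast (ival a) hM
  have hg : 0 < (ival a).natAbs.gcd (bitsToNat M) := Nat.gcd_pos_of_pos_right _ hM
  rw [qEnc, hnum, hden]
  simp only [qnormF, fanoutFn_apply, Function.comp_apply, fstF_boolPair, sndF_boolPair, zcanonF_eq, qgcdF_boolPair,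
    divFn_boolPair, bitsToNat_encodeNat]
  rw [zquoPosF_dpEnc _ _ (by rwa [bitsToNat_encodeNat]), bitsToNat_encodeNat]

/-- `qnormF` on the code of an integer over a positive natural. [folklore] -/
theorem qnormF_dpEnc (Z : ℤ) {M : ℕ} (hM : 0 < M) :
    qnormF (boolPair (dpEnc Z) (encodeNat M)) = qEnc ((Z : ℚ) / (M : ℚ)) := by
  rw [qnormF_boolPair _ _ (by rwa [bitsToNat_encodeNat]), ival_dpEnc, bitsToNat_encodeNat]

/-! ### Rounding -/

/-- **A numeral as a nonnegative difference pair**: `natZF u = ⟨u, ε⟩`, `ival (natZF u) = ⟦u⟧`. [folklore] -/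
noncomputable def natZF : List Bool → List Bool := fanoutFn norm (fun _ => [])

/-- Value of `natZF`: the canonical code of `⟦u⟧`. [folklore] -/
@[simp] theorem natZF_apply (u : List Bool) : natZF u = dpEnc (bitsToNat u : ℤ) := by
  rw [natZF, fanoutFn_apply, dpEnc]
  simp [norm_eq_encodeNat, (by decide : encodeNat 0 = [])]

/-- `natZF ∈ FP`. [cite: AroraBarak2009, §1.3] -/
theorem natZF_mem_FP : natZF ∈ FP := fanoutFn_mem_FP norm_mem_FP (const_mem_FP _)

/-- **Rounding a fraction to the nearest integer** (ties up, Lean's `round`):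
`⟨a, M⟩ ↦ dpEnc ⌊(2 · ival a + ⟦M⟧) / (2 ⟦M⟧)⌋`. [folklore] -/
noncomputable def qroundF : List Bool → List Bool :=
  zquoPosF ∘ fanoutFn (zaddF ∘ fanoutFn (zaddF ∘ fanoutFn fstF fstF) (natZF ∘ sndF)) (addFn ∘ fanoutFn sndF sndF)

/-- `qroundF ∈ FP`. [cite: AroraBarak2009, §1.3] -/
theorem qroundF_mem_FP : qroundF ∈ FP :=
  comp_mem_FP zquoPosF_mem_FP
    (fanoutFn_mem_FP
      (comp_mem_FP zaddF_mem_FP (fanoutFn_mem_FP (comp_mem_FP zaddF_mem_FP (fanoutFn_mem_FP fstF_mem_FP fstF_mem_FP))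
        (comp_mem_FP natZF_mem_FP sndF_mem_FP)))
      (comp_mem_FP addFn_mem_FP (fanoutFn_mem_FP sndF_mem_FP sndF_mem_FP)))

/-- `round (Z / M) = ⌊(2 Z + M) / (2 M)⌋` as an integer division (`M > 0`). [folklore] -/
theorem round_intCast_div_natCast (Z : ℤ) {M : ℕ} (hM : 0 < M) :
    round ((Z : ℚ) / (M : ℚ)) = (2 * Z + M) / ((2 * M : ℕ) : ℤ) := by
  rw [round_eq, ← Rat.floor_intCast_div_natCast]
  congr 1
  have hM' : (M : ℚ) ≠ 0 := by exact_mod_cast hM.ne'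
  push_cast
  field_simp

/-- **`qroundF ⟨a, M⟩ = dpEnc (round (ival a / ⟦M⟧))`** for a positive denominator numeral. [folklore] -/
theorem qroundF_boolPair (a M : List Bool) (hM : 0 < bitsToNat M) :
    qroundF (boolPair a M) = dpEnc (round ((ival a : ℚ) / (bitsToNat M : ℚ))) := by
  rw [round_intCast_div_natCast _ hM]
  simp only [qroundF, Function.comp_apply, fanoutFn_apply, fstF_boolPair, sndF_boolPair, zaddF_boolPair, natZF_apply,
    ival_dpEnc, addFn_boolPair]
  rw [zquoPosF_dpEnc _ _ (by rw [bitsToNat_encodeNat]; omega), bitsToNat_encodeNat]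
  congr 1
  push_cast
  ring_nf

/-- `qroundF` on canonical operands. [folklore] -/
theorem qroundF_dpEnc (Z : ℤ) {M : ℕ} (hM : 0 < M) :
    qroundF (boolPair (dpEnc Z) (encodeNat M)) = dpEnc (round ((Z : ℚ) / (M : ℚ))) := by
  rw [qroundF_boolPair _ _ (by rwa [bitsToNat_encodeNat]), ival_dpEnc, bitsToNat_encodeNat]

end Brick

end Literature.Computability.Complexity
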